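import Mathlib
import Summits.ValiantsHypothesis.ValiantsHypothesis.Theorems.PerCofactorDegreeReduction.Negative.TwoTowerStrict

/-!
# Crux `DivisionGap.PerCofactorDegreeReduction` (stmt-ValiantsHypothesis-15046), line `Sketch` —
# stub `stub_essentiallySignedFactor`: an essentially signed factor modulo `per₃`

**Theorem (`stub_essentiallySignedFactor`).** In the `3 × 3` variables `x_{rc} = X (r, c)` over `ℝ`
put `s = x₀₀ − x₀₁` (a signed linear form), `M = x₁₀x₂₂ + x₁₂x₂₀` (the permanental minor of the cell
`(0,1)`) and `P = x₀₀ · M + R`, `R = x₀₀(x₁₁x₂₂ + x₁₂x₂₁) + x₀₂(x₁₀x₂₁ + x₁₁x₂₀)` (the four permutation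
monomials avoiding `x₀₁`).  Then
1. `per₃ ∣ P − s M` (indeed `P − s M = per₃`);
2. `P` and `M` have nonnegative coefficients;
3. `per₃ ∤ P`;
4. for every real `c ≠ 0` and every `Q` with nonnegative coefficients, `per₃ ∤ Q − c · s`:
   the signed factor `s` of the nonnegative product `s · M ≡ P (mod per₃)` has NO nonnegative
   representative in any nonzero real multiple.

## Proof

1. `P − s M = x₀₁ M + R = per₃` by the column-`0` Laplace expansion
   (`PerCofactorDegreeReductionNegative.perPoly_three_eq`) and `ring`.
2. Sums and products of polynomials with nonnegative coefficients, and variables, have nonnegative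
   coefficients (`coeff_mul` is a sum of products of coefficients).
3. `P ≠ 0` (`P(1,…,1) = 6`) and `P` misses the variable `x₀₁`, while a nonzero multiple of `per₃`
   involves every variable (`PerCofactorDegreeReductionNegative.not_perPoly_dvd_of_degreeOf_eq_zero`).
4. If `Q − c s = per₃ · H`, every degree-`1` coefficient of `per₃ · H` vanishes (`per₃` is a cubic
   form, `perPoly_isHomogeneous`, and `coeff_mul`), so `coeff_{x₀₀} Q = c` and `coeff_{x₀₁} Q = −c`;
   both are `≥ 0`, forcing `c = 0`.
-/

noncomputable section

-- `Summit.ValiantsHypothesis.ValiantsHypothesis.…` is the tree's mandated single-conjunct layout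
-- (Problem = Summit), so the duplicated namespace component is intended.
set_option linter.dupNamespace false

namespace Summit.ValiantsHypothesis.ValiantsHypothesis.Theorems.DivisionGap.PerCofactorDegreeReduction.EssentiallySignedFactor

open MvPolynomial Literature.Computability.AlgebraicComplexity
open Summit.ValiantsHypothesis.Theorems.PerCofactorDegreeReductionNegative
open scoped NNReal

/-! ### Nonnegative coefficients are closed under `+`, `*` and contain the variables -/

section Nonneg

variable {σ : Type*}

/-- A sum of two real polynomials with nonnegative coefficients has nonnegative coefficients.
[folklore] -/
theorem coeff_add_nonneg {f g : MvPolynomial σ ℝ} (hf : ∀ m, 0 ≤ coeff m f)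
    (hg : ∀ m, 0 ≤ coeff m g) : ∀ m, 0 ≤ coeff m (f + g) := fun m => by
  rw [coeff_add]
  exact add_nonneg (hf m) (hg m)

/-- A product of two real polynomials with nonnegative coefficients has nonnegative coefficients
(`coeff_mul`: each coefficient of the product is a sum of products of coefficients). [folklore] -/
theorem coeff_mul_nonneg {f g : MvPolynomial σ ℝ} (hf : ∀ m, 0 ≤ coeff m f)
    (hg : ∀ m, 0 ≤ coeff m g) : ∀ m, 0 ≤ coeff m (f * g) := fun m => by
  classical
  rw [coeff_mul]
  exact Finset.sum_nonneg fun a _ => mul_nonneg (hf _) (hg _)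

/-- A variable has nonnegative coefficients (`0` or `1`). [folklore] -/
theorem coeff_X_nonneg (v : σ) : ∀ m, 0 ≤ coeff m (X v : MvPolynomial σ ℝ) := fun m => by
  classical
  rw [coeff_X]
  split_ifs <;> norm_num

end Nonneg

/-! ### Degree-one coefficients of multiples of the permanent -/

/-- **Low-degree coefficients of a multiple of `per₃` vanish**: if `e` is an exponent of degree `1`
then `coeff e (per₃ · H) = 0` for every `H`, because `per₃` is homogeneous of degree `3`
(`perPoly_isHomogeneous`) and every `a ≤ e` in the convolution `coeff_mul` has degree `≤ 1 ≠ 3`.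
[folklore] -/
theorem coeff_perPoly_mul_eq_zero_of_degree_eq_one (H : MvPolynomial (Fin 3 × Fin 3) ℝ)
    {e : (Fin 3 × Fin 3) →₀ ℕ} (he : e.degree = 1) : coeff e (perPoly (Fin 3) ℝ * H) = 0 := by
  classical
  rw [coeff_mul]
  refine Finset.sum_eq_zero fun a ha => ?_
  have hdeg : a.1.degree ≠ Fintype.card (Fin 3) := by
    have h' := congrArg Finsupp.degree (Finset.HasAntidiagonal.mem_antidiagonal.mp ha)
    rw [map_add, he] at h'
    rw [Fintype.card_fin]
    omega
  rw [perPoly_isHomogeneous.coeff_eq_zero hdeg, zero_mul]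

/-! ### The theorem -/

/-- **stub_essentiallySignedFactor — an essentially signed factor modulo `per₃`.**  With
`s = x₀₀ − x₀₁`, `M = x₁₀x₂₂ + x₁₂x₂₀`, `P = x₀₀ M + x₀₀(x₁₁x₂₂ + x₁₂x₂₁) + x₀₂(x₁₀x₂₁ + x₁₁x₂₀)`:
`per₃ ∣ P − s M` (it equals `per₃`), `P, M ≥ 0` coefficientwise, `per₃ ∤ P` (`P ≠ 0` misses `x₀₁`),
and no `Q ≥ 0` is congruent to a nonzero real multiple `c s` modulo `per₃` (degree-one coefficients
of multiples of the cubic form `per₃` vanish, so `coeff_{x₀₀} Q = c ≥ 0` and `coeff_{x₀₁} Q = −c ≥ 0`).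
[folklore] -/
theorem stub_essentiallySignedFactor (s M P : MvPolynomial (Fin 3 × Fin 3) ℝ)
    (hs : s = X (0, 0) - X (0, 1))
    (hM : M = X (1, 0) * X (2, 2) + X (1, 2) * X (2, 0))
    (hP : P = X (0, 0) * M + (X (0, 0) * (X (1, 1) * X (2, 2) + X (1, 2) * X (2, 1)) +
        X (0, 2) * (X (1, 0) * X (2, 1) + X (1, 1) * X (2, 0)))) :
    perPoly (Fin 3) ℝ ∣ P - s * M ∧
    (∀ m, 0 ≤ coeff m P) ∧ (∀ m, 0 ≤ coeff m M) ∧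
    ¬ perPoly (Fin 3) ℝ ∣ P ∧
    (∀ (c : ℝ) (Q : MvPolynomial (Fin 3 × Fin 3) ℝ), c ≠ 0 → (∀ m, 0 ≤ coeff m Q) →
      ¬ perPoly (Fin 3) ℝ ∣ Q - C c * s) := by
  -- (1) `P - s M = per₃`
  have h1 : P - s * M = perPoly (Fin 3) ℝ := by
    rw [hP, hM, hs, perPoly_three_eq]
    unfold P00 P10 P20 x
    ring
  -- (2) nonnegative coefficients
  have hMnn : ∀ m, 0 ≤ coeff m M := by
    rw [hM]
    exact coeff_add_nonneg (coeff_mul_nonneg (coeff_X_nonneg _) (coeff_X_nonneg _))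
      (coeff_mul_nonneg (coeff_X_nonneg _) (coeff_X_nonneg _))
  have hPnn : ∀ m, 0 ≤ coeff m P := by
    rw [hP]
    exact coeff_add_nonneg (coeff_mul_nonneg (coeff_X_nonneg _) hMnn)
      (coeff_add_nonneg
        (coeff_mul_nonneg (coeff_X_nonneg _)
          (coeff_add_nonneg (coeff_mul_nonneg (coeff_X_nonneg _) (coeff_X_nonneg _))
            (coeff_mul_nonneg (coeff_X_nonneg _) (coeff_X_nonneg _))))
        (coeff_mul_nonneg (coeff_X_nonneg _)
          (coeff_add_nonneg (coeff_mul_nonneg (coeff_X_nonneg _) (coeff_X_nonneg _))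
            (coeff_mul_nonneg (coeff_X_nonneg _) (coeff_X_nonneg _)))))
  -- (3) `per₃ ∤ P`: `P ≠ 0` (`P(1,…,1) = 6`) misses the variable `x₀₁`
  have hP0 : P ≠ 0 := fun h => by
    have h6 : eval (fun _ => (1 : ℝ)) P = 6 := by
      simp only [hP, hM, map_add, map_mul, eval_X]
      norm_num
    rw [h, map_zero] at h6
    norm_num at h6
  have hX : ∀ w : Fin 3 × Fin 3, ((0 : Fin 3), (1 : Fin 3)) ≠ w →
      degreeOf ((0 : Fin 3), (1 : Fin 3)) (X w : MvPolynomial (Fin 3 × Fin 3) ℝ) = 0 :=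
    fun w hw => MvPolynomial.degreeOf_X_of_ne hw
  have hdM : degreeOf ((0 : Fin 3), (1 : Fin 3)) M = 0 := by
    rw [hM]
    exact degreeOf_add_eq_zero _ (degreeOf_mul_eq_zero _ (hX _ (by decide)) (hX _ (by decide)))
      (degreeOf_mul_eq_zero _ (hX _ (by decide)) (hX _ (by decide)))
  have hdP : degreeOf ((0 : Fin 3), (1 : Fin 3)) P = 0 := by
    rw [hP]
    exact degreeOf_add_eq_zero _ (degreeOf_mul_eq_zero _ (hX _ (by decide)) hdM)
      (degreeOf_add_eq_zero _
        (degreeOf_mul_eq_zero _ (hX _ (by decide))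
          (degreeOf_add_eq_zero _ (degreeOf_mul_eq_zero _ (hX _ (by decide)) (hX _ (by decide)))
            (degreeOf_mul_eq_zero _ (hX _ (by decide)) (hX _ (by decide)))))
        (degreeOf_mul_eq_zero _ (hX _ (by decide))
          (degreeOf_add_eq_zero _ (degreeOf_mul_eq_zero _ (hX _ (by decide)) (hX _ (by decide)))
            (degreeOf_mul_eq_zero _ (hX _ (by decide)) (hX _ (by decide))))))
  refine ⟨⟨1, by rw [mul_one, h1]⟩, hPnn, hMnn, not_perPoly_dvd_of_degreeOf_eq_zero hP0 _ hdP, ?_⟩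
  -- (4) no nonnegative representative of `c s`, `c ≠ 0`
  rintro c Q hc hQ ⟨H, hH⟩
  -- degree-one coefficients: `coeff e Q = c * coeff e s`
  have hcoeff : ∀ e : (Fin 3 × Fin 3) →₀ ℕ, e.degree = 1 → coeff e Q = c * coeff e s := by
    intro e he
    have h' := congrArg (coeff e) hH
    rwa [coeff_sub, coeff_C_mul, coeff_perPoly_mul_eq_zero_of_degree_eq_one H he,
      sub_eq_zero] at h'
  have hne : Finsupp.single ((0 : Fin 3), (0 : Fin 3)) 1 ≠
      Finsupp.single ((0 : Fin 3), (1 : Fin 3)) 1 := by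
    rw [Ne, Finsupp.single_left_inj one_ne_zero]
    decide
  have h00 := hcoeff (Finsupp.single (0, 0) 1) (Finsupp.degree_single _ _)
  have h01 := hcoeff (Finsupp.single (0, 1) 1) (Finsupp.degree_single _ _)
  rw [hs, coeff_sub, coeff_X_same, coeff_X, if_neg hne.symm] at h00
  rw [hs, coeff_sub, coeff_X_same, coeff_X, if_neg hne] at h01
  have hQ0 := hQ (Finsupp.single (0, 0) 1)
  have hQ1 := hQ (Finsupp.single (0, 1) 1)
  rw [h00] at hQ0
  rw [h01] at hQ1
  apply hc
  linarith

end Summit.ValiantsHypothesis.ValiantsHypothesis.Theorems.DivisionGap.PerCofactorDegreeReduction.EssentiallySignedFactor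

end
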